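import Literature.Dynamics.TopologicalDynamics.EntropyOfProducts
import Literature.AlgebraicGeometry.HodgeTheory.AbelianVarietyMultiplicationEntropy
import Literature.AlgebraicGeometry.HodgeTheory.AbelianVarietyTranslationsZeroEntropy
import Mathlib.Topology.UniformSpace.OfCompactT2
import HarnessLib

/-!
# `h(φ × ψ) = h(φ) + h(ψ)` on `A(ℂ) × B(ℂ)` for complex abelian varieties, and
# `h((P, Q) ↦ (Pᵐ·P₀, Qⁿ·Q₀)) = 2g_A · log|m| + 2g_B · log|n|` (Walters Thm 7.10 (ii) with Thm 8.15)

Lane `lit-hodgefound`, row A1-30⁺⁶⁵ (prover seat `lit-hodgefound-p31`): the lane file of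
`Literature/Dynamics/TopologicalDynamics/EntropyOfProducts.lean` (`h(T × S; F × G) = h(T; F) + h(S; G)` for Mathlib's
`coverEntropy`), combined with row A1-30⁺⁶⁰ (`AbelianVarietyMultiplicationEntropy`: `h(P ↦ Pᵐ·Q) = 2g · log|m|` on
`A(ℂ)`, `h(t ↦ m·t + a) = |ι| · log|m|` on a complex torus).

## The printed statements

P. Walters, *An Introduction to Ergodic Theory* (GTM 79, 1982; held), §7.2 **Theorem 7.10 (ii)** (chunk p0183) «If
either `X₁` or `X₂` is compact then `h_d(T₁ × T₂) = h_{d₁}(T₁) + h_{d₂}(T₂)`»; §8.4 Theorem 8.15 (chunk p0212, the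
entropy of `x ↦ A·x` on a torus).  M. Viana, K. Oliveira, *Foundations of Ergodic Theory* (2016; held), §10.2.6
Exercise 10.2.1 (chunk p0324) and §10.2.5 Proposition 10.2.10 (chunks p0322–p0323).

## What is formalised (theorems only; no definition, no named fact)

* §1 complex tori `X = E/Φ(ℤ^ι)`, `X' = E'/Φ'(ℤ^ι')`: `ComplexTorus.coverEntropy_prodMap` (`h(φ × ψ) = h(φ) + h(ψ)` for
  all self-maps, every uniform structure on `X × X'` inducing the product topology and every compatible uniformity
  on the factors) and **`ComplexTorus.coverEntropy_prodMap_zsmul_add_const`**: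
  `h((s, t) ↦ (m·s + a, n·t + b)) = |ι| · log|m| + |ι'| · log|n|`.
* §2 complex abelian varieties `A`, `B` of dimensions `g_A`, `g_B`: **`AbelianVariety.coverEntropy_prodMap`** —
  `h(φ × ψ) = h(φ) + h(ψ)` for all self-maps `φ` of `A(ℂ)` and `ψ` of `B(ℂ)` (in particular `f(ℂ) × g(ℂ)` for
  endomorphisms), every uniform structure on `A(ℂ) × B(ℂ)` inducing the product of the complex topologies — and
  **`AbelianVariety.coverEntropy_prodMap_zpow_mul`**: `h((P, Q) ↦ (Pᵐ·P₀, Qⁿ·Q₀)) = 2g_A · log|m| + 2g_B · log|n|`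
  (`m, n ∈ ℤ`), with the special case `AbelianVariety.coverEntropy_prodMap_zpow` (`P₀ = Q₀ = 1`), and the riders
  `ComplexTorus.coverEntropy_prodMap_add_const` / **`AbelianVariety.coverEntropy_prodMap_mul_right`** (a translation on
  one factor does not change the entropy: `h((P, Q) ↦ (P·P₀, ψ Q)) = h(ψ)`, with Walters §7.3 `h(τ) = 0`, the tree's
  `AbelianVarietyTranslationsZeroEntropy`).

## References

* [Walters1982] P. Walters, *An Introduction to Ergodic Theory*, GTM 79 (1982), §7.2 Theorem 7.10 (ii) (held text
  chunks p0183–p0184), §8.4 Theorem 8.15 (chunk p0212).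
* [VianaOliveira2015] M. Viana, K. Oliveira, *Foundations of Ergodic Theory*, CUP (2016), §10.2.6 Exercise 10.2.1
  (held text chunk p0324), §10.2.5 Proposition 10.2.10 (chunks p0322–p0323).
-/

noncomputable section

open Set Function Filter Topology Dynamics
open CategoryTheory
open Literature.Dynamics.TopologicalDynamics
open Literature.AlgebraicGeometry.Motives (ComplexPoints AbelianVariety AlgPoints)

/-! ### §1 Products of complex tori -/

namespace Literature.Geometry.Kaehler.ComplexTorus

variable {ι : Type*} {E : Type*} [NormedAddCommGroup E] [NormedSpace ℂ E] (Φ : (ι → ℝ) ≃L[ℝ] E)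
  {ι' : Type*} {E' : Type*} [NormedAddCommGroup E'] [NormedSpace ℂ E'] (Φ' : (ι' → ℝ) ≃L[ℝ] E')

/-- **`h(φ × ψ) = h(φ) + h(ψ)` for self-maps of two complex tori** `X = E/Φ(ℤ^ι)`, `X' = E'/Φ'(ℤ^ι')`, for every
uniform structure on `X × X'` inducing the product topology and every compatible uniformities on `X`, `X'`.
[cite: Walters1982, §7.2 Theorem 7.10 (ii) (held text chunks p0183–p0184)]
[cite: VianaOliveira2015, §10.2.6 Exercise 10.2.1 (held text chunk p0324)] -/
theorem coverEntropy_prodMap (uX : UniformSpace (ComplexTorus Φ))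
    (huX : uX.toTopologicalSpace = ComplexTorus.instTopologicalSpace Φ) (uY : UniformSpace (ComplexTorus Φ'))
    (huY : uY.toTopologicalSpace = ComplexTorus.instTopologicalSpace Φ')
    (u : UniformSpace (ComplexTorus Φ × ComplexTorus Φ')) (hu : u.toTopologicalSpace = instTopologicalSpaceProd)
    (φ : ComplexTorus Φ → ComplexTorus Φ) (ψ : ComplexTorus Φ' → ComplexTorus Φ') :
    @coverEntropy (ComplexTorus Φ × ComplexTorus Φ') u (Prod.map φ ψ) univ =
      @coverEntropy (ComplexTorus Φ) uX φ univ + @coverEntropy (ComplexTorus Φ') uY ψ univ :=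
  ProductEntropy.coverEntropy_prod_univ_of_toTopologicalSpace_eq uX huX uY huY u hu φ ψ

/-- **`h((s, t) ↦ (m·s + a, n·t + b)) = |ι| · log|m| + |ι'| · log|n|` on `X × X'`** (Walters Thm 7.10 (ii) with
Thm 8.15 on each factor), every uniform structure inducing the product topology.
[cite: Walters1982, §7.2 Theorem 7.10 (ii) (held text chunk p0183) and §8.4 Theorem 8.15 (chunk p0212)]
[cite: VianaOliveira2015, §10.2.5 Proposition 10.2.10 (held text chunks p0322–p0323)] -/
theorem coverEntropy_prodMap_zsmul_add_const [Fintype ι] [Fintype ι'] (u : UniformSpace (ComplexTorus Φ × ComplexTorus Φ'))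
    (hu : u.toTopologicalSpace = instTopologicalSpaceProd) (m n : ℤ) (a : ComplexTorus Φ) (b : ComplexTorus Φ') :
    @coverEntropy (ComplexTorus Φ × ComplexTorus Φ') u (Prod.map (fun s ↦ m • s + a) (fun t ↦ n • t + b)) univ =
      ((Fintype.card ι * Real.log |(m : ℝ)| + Fintype.card ι' * Real.log |(n : ℝ)| : ℝ) : EReal) := by
  rw [coverEntropy_prodMap Φ Φ' (Pi.uniformSpace fun _ : ι ↦ UnitAddCircle) rfl
    (Pi.uniformSpace fun _ : ι' ↦ UnitAddCircle) rfl u hu,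
    ComplexTorus.coverEntropy_zsmul_add_const Φ _ rfl m a, ComplexTorus.coverEntropy_zsmul_add_const Φ' _ rfl n b,
    ← EReal.coe_add]

/-- **`h(τ_a × ψ) = h(ψ)`: a translation on the first factor does not change the entropy** — for every self-map
`ψ` of `X'`, `h((s, t) ↦ (s + a, ψ t)) = h(ψ)` (the product formula with Walters §7.3, `h(τ_a) = 0`, the tree's
`ComplexTorus.coverEntropy_add_univ_eq_zero`), every uniform structure inducing the product topology and every
compatible uniformity on `X'`. [cite: Walters1982, §7.2 Theorem 7.10 (ii) (held text chunk p0183) and §7.3 (chunk p0188)] -/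
theorem coverEntropy_prodMap_add_const (uY : UniformSpace (ComplexTorus Φ'))
    (huY : uY.toTopologicalSpace = ComplexTorus.instTopologicalSpace Φ')
    (u : UniformSpace (ComplexTorus Φ × ComplexTorus Φ')) (hu : u.toTopologicalSpace = instTopologicalSpaceProd)
    (a : ComplexTorus Φ) (ψ : ComplexTorus Φ' → ComplexTorus Φ') :
    @coverEntropy (ComplexTorus Φ × ComplexTorus Φ') u (Prod.map (fun s ↦ s + a) ψ) univ =
      @coverEntropy (ComplexTorus Φ') uY ψ univ := by
  rw [coverEntropy_prodMap Φ Φ' (Pi.uniformSpace fun _ : ι ↦ UnitAddCircle) rfl uY huY u hu,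
    ComplexTorus.coverEntropy_add_univ_eq_zero Φ _ rfl a, zero_add]

end Literature.Geometry.Kaehler.ComplexTorus

/-! ### §2 Products of complex abelian varieties -/

namespace Literature.AlgebraicGeometry.HodgeTheory

section Entropy

variable (A B : AbelianVariety ℂ)

/-- **Walters Thm 7.10 (ii) on `A(ℂ) × B(ℂ)`: `h(φ × ψ) = h(φ) + h(ψ)`** for all self-maps `φ` of `A(ℂ)` and `ψ` of
`B(ℂ)` (e.g. `f(ℂ) × g(ℂ)` for endomorphisms `f` of `A`, `g` of `B`), for every uniform structure on `A(ℂ) × B(ℂ)`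
inducing the product of the complex topologies and every compatible uniformities on the (compact) factors.
[cite: Walters1982, §7.2 Theorem 7.10 (ii) (held text chunks p0183–p0184)]
[cite: VianaOliveira2015, §10.2.6 Exercise 10.2.1 (held text chunk p0324)] -/
theorem AbelianVariety.coverEntropy_prodMap (uA : UniformSpace (A.Points ℂ))
    (huA : uA.toTopologicalSpace = (inferInstance : TopologicalSpace (A.Points ℂ))) (uB : UniformSpace (B.Points ℂ))
    (huB : uB.toTopologicalSpace = (inferInstance : TopologicalSpace (B.Points ℂ)))
    (u : UniformSpace (A.Points ℂ × B.Points ℂ)) (hu : u.toTopologicalSpace = instTopologicalSpaceProd)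
    (φ : A.Points ℂ → A.Points ℂ) (ψ : B.Points ℂ → B.Points ℂ) :
    @coverEntropy (A.Points ℂ × B.Points ℂ) u (Prod.map φ ψ) univ =
      @coverEntropy (A.Points ℂ) uA φ univ + @coverEntropy (B.Points ℂ) uB ψ univ :=
  ProductEntropy.coverEntropy_prod_univ_of_toTopologicalSpace_eq uA huA uB huB u hu φ ψ

/-- **`h((P, Q) ↦ (Pᵐ·P₀, Qⁿ·Q₀)) = 2g_A · log|m| + 2g_B · log|n|` on `A(ℂ) × B(ℂ)`** (`m, n ∈ ℤ`; the product
formula with row A1-30⁺⁶⁰'s `h(P ↦ Pᵐ·Q) = 2g · log|m|`), every uniform structure inducing the product topology and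
every compatible uniformities on the factors.
[cite: Walters1982, §7.2 Theorem 7.10 (ii) (held text chunk p0183) and §8.4 Theorem 8.15 (chunk p0212)]
[cite: VianaOliveira2015, §10.2.5 Proposition 10.2.10 (held text chunks p0322–p0323)] -/
theorem AbelianVariety.coverEntropy_prodMap_zpow_mul (uA : UniformSpace (A.Points ℂ))
    (huA : uA.toTopologicalSpace = (inferInstance : TopologicalSpace (A.Points ℂ))) (uB : UniformSpace (B.Points ℂ))
    (huB : uB.toTopologicalSpace = (inferInstance : TopologicalSpace (B.Points ℂ)))
    (u : UniformSpace (A.Points ℂ × B.Points ℂ)) (hu : u.toTopologicalSpace = instTopologicalSpaceProd)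
    (m n : ℤ) (P₀ : A.Points ℂ) (Q₀ : B.Points ℂ) :
    @coverEntropy (A.Points ℂ × B.Points ℂ) u
        (Prod.map (fun P : A.Points ℂ ↦ P ^ m * P₀) (fun Q : B.Points ℂ ↦ Q ^ n * Q₀)) univ =
      ((2 * A.dim * Real.log |(m : ℝ)| + 2 * B.dim * Real.log |(n : ℝ)| : ℝ) : EReal) := by
  rw [AbelianVariety.coverEntropy_prodMap A B uA huA uB huB u hu, AbelianVariety.coverEntropy_zpow_mul_eq A uA huA m P₀,
    AbelianVariety.coverEntropy_zpow_mul_eq B uB huB n Q₀, ← EReal.coe_add]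

/-- **`h((P, Q) ↦ (Pᵐ, Qⁿ)) = 2g_A · log|m| + 2g_B · log|n|` on `A(ℂ) × B(ℂ)`** — the product of the multiplications
`m_A × n_B` on complex points. [cite: Walters1982, §7.2 Theorem 7.10 (ii) (held text chunk p0183) and §8.4 Theorem 8.15 (chunk p0212)]
[cite: VianaOliveira2015, §10.2.5 Proposition 10.2.10 (held text chunks p0322–p0323)] -/
theorem AbelianVariety.coverEntropy_prodMap_zpow (uA : UniformSpace (A.Points ℂ))
    (huA : uA.toTopologicalSpace = (inferInstance : TopologicalSpace (A.Points ℂ))) (uB : UniformSpace (B.Points ℂ))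
    (huB : uB.toTopologicalSpace = (inferInstance : TopologicalSpace (B.Points ℂ)))
    (u : UniformSpace (A.Points ℂ × B.Points ℂ)) (hu : u.toTopologicalSpace = instTopologicalSpaceProd) (m n : ℤ) :
    @coverEntropy (A.Points ℂ × B.Points ℂ) u
        (Prod.map (fun P : A.Points ℂ ↦ P ^ m) (fun Q : B.Points ℂ ↦ Q ^ n)) univ =
      ((2 * A.dim * Real.log |(m : ℝ)| + 2 * B.dim * Real.log |(n : ℝ)| : ℝ) : EReal) := by
  simpa only [mul_one] using AbelianVariety.coverEntropy_prodMap_zpow_mul A B uA huA uB huB u hu m n 1 1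

/-- **`h((P, Q) ↦ (P·P₀, ψ Q)) = h(ψ)` on `A(ℂ) × B(ℂ)`: a translation on one factor does not change the
entropy** (product formula with Walters §7.3, the tree's `AbelianVariety.coverEntropy_mul_right_univ_eq_zero`), for
every self-map `ψ` of `B(ℂ)`, every uniform structure inducing the product topology, every compatible uniformity
on `B(ℂ)`. [cite: Walters1982, §7.2 Theorem 7.10 (ii) (held text chunk p0183) and §7.3 (chunk p0188)] -/
theorem AbelianVariety.coverEntropy_prodMap_mul_right (uB : UniformSpace (B.Points ℂ))
    (huB : uB.toTopologicalSpace = (inferInstance : TopologicalSpace (B.Points ℂ)))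
    (u : UniformSpace (A.Points ℂ × B.Points ℂ)) (hu : u.toTopologicalSpace = instTopologicalSpaceProd)
    (P₀ : A.Points ℂ) (ψ : B.Points ℂ → B.Points ℂ) :
    @coverEntropy (A.Points ℂ × B.Points ℂ) u (Prod.map (fun P : A.Points ℂ ↦ P * P₀) ψ) univ =
      @coverEntropy (B.Points ℂ) uB ψ univ := by
  -- the factor `A(ℂ)` carries no uniformity instance: use the one of the compact Hausdorff space `A(ℂ)`
  rw [AbelianVariety.coverEntropy_prodMap A B uniformSpaceOfCompactR1 rfl uB huB u hu,
    AbelianVariety.coverEntropy_mul_right_univ_eq_zero A _ rfl P₀, zero_add]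

end Entropy

end Literature.AlgebraicGeometry.HodgeTheory
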